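import Summits.Ventures.HodgeRepro.Statements
import Summits.Ventures.HodgeRepro.Examples
import Summits.Ventures.HodgeRepro.GSetHodge

/-!
# The sealed degree-6 coordinate census (§A.3) read in the finite-group model

Blind re-derivation cell `pub-hodge-repro`, seat `typer` (gen 3).  Bridges the vocabulary of the sealed
`Statements.lean` §A.3 (`FaceCensus.Sextic.Coordinates`: `isCMType`, `bar`, `isInduced`, `act`, `phi`,
`eq32`, `hodgeSets`, `divisorSets` on `ℤ/6` and `Pt = ℤ/6 ⊔ ℤ/2`) to the model of `CMType.lean` /
`Primitive.lean` / `GSetHodge.lean` on the group `C6 = Multiplicative (ZMod 6)` with conjugation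
`cc_C6 = σ³` (`Groups.lean`).  Nothing here proves any conjunct of the sealed `Census`; the lemmas say
what each sealed definition IS in the general model:

* `toC6 T` — a coordinate type `T ⊆ ℤ/6` as a subset of `C6`; `isCMType_iff`: the sealed `isCMType` is
  `IsCMType cc_C6`; `mem_cmTypes_iff`; the sealed `cmTypes` is `cmTypes cc_C6` (`cmTypes_map`), hence
  `8` types by `card_cmTypes_C6` (no new computation);
* `toC6_bar`: the conjugate type `T + 3` is `cc_C6 • toC6 T`; `toC6_image_add`: translation `T + a`
  is the Galois translate `σᵃ • _` = the twist `rmul _ σᵃ` (`C6` is abelian);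
* `isInduced_iff`: `T + 2 = T` is `σ² ∈ rstab (toC6 T)` (`Primitive.lean`), and for CM types
  `isInduced_eq_false_iff`: not induced = `IsPrimitive`; the induced types are `Φ6'` and its conjugate;
* `MulAction C6 Pt`: the sealed Galois action `act` is a `C6`-action on `Pt` (`smul_eq_act`), `phi` is a
  CM type on the `G`-set `Pt` (`isCMTypeOn_phi`: the CM algebra `F × k` of `B × E`);
* `eq32_iff`: the sealed Pohlmann condition with multiplicity `m` is `|P ∩ g • phi| = m` for all `g`;
  `mem_hodgeSets_iff` / `mem_divisorSets_iff`: the sealed `hodgeSets` / `divisorSets` are the Pohlmann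
  `4`-sets / `2`-sets of `(Pt, phi)` (`IsHodgeSetOn`), the non-`c`-stable ones the exceptional ones;
  `card_hodgeSets_eq` / `card_divisorSets_eq`: their numbers are `hodgeCountOn cc_C6 phi 2 / 1`, and
  these evaluate to `8 = 6 + 2` and `4 = 4 + 0` (`decide`).
-/

open Finset
open scoped Pointwise

namespace HodgeRepro

namespace SexticBridge

open Summit.Ventures.HodgeRepro.FaceCensus.Sextic
open Multiplicative

/-! ### Coordinate types as subsets of `C6` -/

/-- A coordinate type `T ⊆ ℤ/6` as a subset of `C6 = Multiplicative (ZMod 6)`: `i ↦ σⁱ`. -/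
def toC6 (T : Finset (ZMod 6)) : Finset C6 := T.map (ofAdd : ZMod 6 ≃ C6).toEmbedding

/-- Membership in `toC6 T`. -/
@[simp] theorem mem_toC6 {T : Finset (ZMod 6)} {g : C6} : g ∈ toC6 T ↔ toAdd g ∈ T := by
  rw [toC6, Finset.mem_map_equiv, ofAdd_symm_eq]

/-- `toC6` preserves cardinality. -/
@[simp] theorem card_toC6 (T : Finset (ZMod 6)) : (toC6 T).card = T.card := Finset.card_map _

/-- `toC6` is injective. -/
theorem toC6_injective : Function.Injective toC6 := by
  intro T T' h
  ext i
  have := Finset.ext_iff.1 h (ofAdd i)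
  simpa using this

/-- Every subset of `C6` is a `toC6`. -/
theorem toC6_surjective : Function.Surjective toC6 := by
  intro Φ
  refine ⟨Φ.map (toAdd : C6 ≃ ZMod 6).toEmbedding, ?_⟩
  ext g
  rw [mem_toC6, Finset.mem_map_equiv, toAdd_symm_eq, ofAdd_toAdd]

/-- Translation of coordinates `T + a` is the Galois translate `σᵃ • toC6 T`. -/
theorem toC6_image_add (T : Finset (ZMod 6)) (a : ZMod 6) :
    toC6 (T.image fun i => i + a) = ofAdd a • toC6 T := by
  ext g
  rw [mem_toC6, Finset.mem_image, ← inv_smul_mem_iff, mem_toC6, smul_eq_mul, toAdd_mul, toAdd_inv,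
    toAdd_ofAdd]
  constructor
  · rintro ⟨i, hi, h⟩
    rw [← h, add_comm i a, neg_add_cancel_left]; exact hi
  · intro h
    exact ⟨-a + toAdd g, h, by abel⟩

/-- Translation of coordinates `T + a` is also the twist `rmul (toC6 T) σᵃ` (`C6` is abelian). -/
theorem toC6_image_add_rmul (T : Finset (ZMod 6)) (a : ZMod 6) :
    toC6 (T.image fun i => i + a) = rmul (toC6 T) (ofAdd a) := by
  rw [toC6_image_add]
  ext g
  rw [mem_rmul, ← inv_smul_mem_iff, smul_eq_mul, mul_comm]

/-! ### CM types -/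

/-- The sealed `isCMType` is `IsCMType cc_C6` on `toC6 T`. -/
theorem isCMType_iff (T : Finset (ZMod 6)) : Coordinates.isCMType T = true ↔ IsCMType cc_C6 (toC6 T) := by
  simp only [Coordinates.isCMType, decide_eq_true_iff, IsCMType, mem_toC6, cc_C6, toAdd_mul, toAdd_ofAdd]
  constructor
  · intro h g
    rw [add_comm]; exact h _
  · intro h i
    have := h (ofAdd i)
    rwa [toAdd_ofAdd, add_comm] at this

/-- Membership in the sealed `cmTypes` is `IsCMType cc_C6` (the size condition `|T| = 3` is automatic). -/
theorem mem_cmTypes_iff (T : Finset (ZMod 6)) : T ∈ Coordinates.cmTypes ↔ IsCMType cc_C6 (toC6 T) := by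
  simp only [Coordinates.cmTypes, mem_filter, mem_powersetCard, subset_univ, true_and, isCMType_iff]
  constructor
  · exact fun h => h.2
  · intro h
    refine ⟨?_, h⟩
    have h1 := h.two_mul_card cc_C6_isComplexConj
    rw [card_toC6, card_C6] at h1
    omega

/-- The sealed `cmTypes`, read in `C6`, is `cmTypes cc_C6` of `CMType.lean`. -/
theorem cmTypes_map : Coordinates.cmTypes.map ⟨toC6, toC6_injective⟩ = HodgeRepro.cmTypes cc_C6 := by
  ext Φ
  rw [Finset.mem_map, HodgeRepro.mem_cmTypes]
  constructor
  · rintro ⟨T, hT, rfl⟩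
    exact (mem_cmTypes_iff T).1 hT
  · intro h
    obtain ⟨T, rfl⟩ := toC6_surjective Φ
    exact ⟨T, (mem_cmTypes_iff T).2 h, rfl⟩

/-- The first sealed number, from the model: `|cmTypes| = |HodgeRepro.cmTypes cc_C6| = 8` (`Groups.lean`). -/
theorem card_cmTypes_eq : Coordinates.cmTypes.card = (HodgeRepro.cmTypes cc_C6).card := by
  rw [← cmTypes_map, Finset.card_map]

/-- The sealed `cmTypes` has `8` elements, by `card_cmTypes_C6` (no new enumeration). -/
theorem card_cmTypes : Coordinates.cmTypes.card = 8 := by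
  rw [card_cmTypes_eq, card_cmTypes_C6]

/-- The conjugate type `T̄ = T + 3` is `cc_C6 • toC6 T`. -/
theorem toC6_bar (T : Finset (ZMod 6)) : toC6 (Coordinates.bar T) = cc_C6 • toC6 T :=
  toC6_image_add T 3

/-- The flip at the place `{p, p + 3}` is the symmetric difference with the conjugate pair `{σᵖ, c σᵖ}`. -/
theorem toC6_flip (p : ZMod 6) (T : Finset (ZMod 6)) :
    toC6 (Coordinates.flip p T) = symmDiff (toC6 T) {ofAdd p, cc_C6 * ofAdd p} := by
  unfold toC6 Coordinates.flip
  rw [Finset.map_eq_image, Finset.map_eq_image, image_symmDiff _ _ (Function.Embedding.injective _),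
    Finset.image_insert, Finset.image_singleton]
  congr 2
  rw [Equiv.coe_toEmbedding, ofAdd_add, cc_C6, mul_comm]

/-! ### Induced and primitive types -/

/-- The sealed `isInduced` (`T + 2 = T`) says `σ² ∈ rstab (toC6 T)` (`Primitive.lean`). -/
theorem isInduced_iff (T : Finset (ZMod 6)) :
    Coordinates.isInduced T = true ↔ (ofAdd 2 : C6) ∈ rstab (toC6 T) := by
  rw [Coordinates.isInduced, decide_eq_true_iff, mem_rstab, ← toC6_image_add_rmul, toC6_injective.eq_iff]

/-- Hence `isInduced T` says `toC6 T` is induced from the subgroup `⟨σ²⟩` (`IsInducedFrom`). -/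
theorem isInduced_iff_isInducedFrom (T : Finset (ZMod 6)) :
    Coordinates.isInduced T = true ↔ IsInducedFrom (toC6 T) (Subgroup.zpowers (ofAdd 2 : C6)) := by
  rw [isInduced_iff]
  constructor
  · exact isInducedFrom_zpowers_of_mem
  · intro h
    exact h (Subgroup.mem_zpowers _)

/-- In `C6` a CM type is primitive iff `σ²` does not stabilise it (`decide` over the `64` subsets;
the only subgroups of `C6` not containing `σ³ = c` are `1` and `⟨σ²⟩`). -/
theorem isPrimitive_iff_C6 (Φ : Finset C6) (hΦ : IsCMType cc_C6 Φ) :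
    IsPrimitive Φ ↔ (ofAdd 2 : C6) ∉ rstab Φ := by
  revert Φ; decide

/-- For a sealed CM type, `isInduced T = false` is primitivity of `toC6 T`. -/
theorem isInduced_eq_false_iff (T : Finset (ZMod 6)) (hT : T ∈ Coordinates.cmTypes) :
    Coordinates.isInduced T = false ↔ IsPrimitive (toC6 T) := by
  rw [isPrimitive_iff_C6 _ ((mem_cmTypes_iff T).1 hT), ← isInduced_iff, Bool.eq_false_iff, Ne,
    Bool.not_eq_true]

/-- The two sealed induced types are `Φ6'` (`Examples.lean`) and its conjugate. -/
theorem toC6_induced : toC6 {0, 2, 4} = Φ6' ∧ toC6 {1, 3, 5} = cc_C6 • Φ6' := by decide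

/-- The sealed reference type `{0, 1, 2}` is `Φ6` of `Examples.lean`. -/
theorem toC6_zero_one_two : toC6 {0, 1, 2} = Φ6 := by decide

/-! ### The Galois action on `Pt = Hom(F, ℂ) ⊔ Hom(k, ℂ)` -/

/-- The sealed action `act` of `σᵍ` on `Pt = ℤ/6 ⊔ ℤ/2` as a `MulAction` of `C6` (`decide` on the two
axioms: `8` resp. `288` cases). -/
instance instMulActionC6Pt : MulAction C6 Coordinates.Pt where
  smul g x := Coordinates.act (toAdd g) x
  one_smul := by decide
  mul_smul := by decide

/-- The action unfolds to the sealed `act`. -/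
theorem smul_eq_act (g : C6) (x : Coordinates.Pt) : g • x = Coordinates.act (toAdd g) x := rfl

/-- The sealed `act g` is the action of `σᵍ`. -/
theorem act_eq_smul (g : ZMod 6) (x : Coordinates.Pt) : Coordinates.act g x = ofAdd g • x := rfl

/-- `phi` (`B` of type `{0,1,2}`, `E` of type `{1}`) is a CM type on the `C6`-set `Pt`: the CM type of the
CM algebra `F × k` of `Y = B × E`. -/
theorem isCMTypeOn_phi : IsCMTypeOn cc_C6 Coordinates.phi := by decide

/-- The `F`-block of `phi` is `Φ6` and its `k`-block is `{1}`. -/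
theorem phi_blocks :
    (Coordinates.phi.filter fun x => x.isLeft).image (fun x => ofAdd (x.getLeft?.getD 0)) = Φ6 ∧
    (Coordinates.phi.filter fun x => x.isRight) = {Sum.inr 1} := by decide

/-! ### Pohlmann's condition -/

/-- The sealed filter `{x ∈ P : act g x ∈ phi}` is `P ∩ σ⁻ᵍ • phi`. -/
theorem filter_act_eq_inter (g : ZMod 6) (P : Finset Coordinates.Pt) :
    (P.filter fun x => Coordinates.act g x ∈ Coordinates.phi) = P ∩ (ofAdd g)⁻¹ • Coordinates.phi := by
  ext x
  rw [mem_filter, mem_inter, mem_inv_smul_finset_iff, act_eq_smul]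

/-- The sealed `eq32 m` is the weight form of Pohlmann's condition: `|P ∩ g • phi| = m` for every `g`. -/
theorem eq32_iff (m : ℕ) (P : Finset Coordinates.Pt) :
    Coordinates.eq32 m P = true ↔ ∀ g : C6, (P ∩ g • Coordinates.phi).card = m := by
  simp only [Coordinates.eq32, decide_eq_true_iff, filter_act_eq_inter]
  constructor
  · intro h g
    have := h (toAdd g⁻¹)
    rwa [ofAdd_toAdd, inv_inv] at this
  · intro h g
    exact h _

/-- For a `4`-set, `eq32 2` is Pohlmann's condition `IsHodgeSetOn cc_C6 phi`. -/
theorem eq32_two_iff (P : Finset Coordinates.Pt) (hP : P.card = 4) :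
    Coordinates.eq32 2 P = true ↔ IsHodgeSetOn cc_C6 Coordinates.phi P := by
  rw [eq32_iff, isHodgeSetOn_iff_forall_card_eq cc_C6_isComplexConj isCMTypeOn_phi P 2 hP]

/-- For a `2`-set, `eq32 1` is Pohlmann's condition `IsHodgeSetOn cc_C6 phi`. -/
theorem eq32_one_iff (P : Finset Coordinates.Pt) (hP : P.card = 2) :
    Coordinates.eq32 1 P = true ↔ IsHodgeSetOn cc_C6 Coordinates.phi P := by
  rw [eq32_iff, isHodgeSetOn_iff_forall_card_eq cc_C6_isComplexConj isCMTypeOn_phi P 1 hP]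

/-- The sealed `hodgeSets` are the Pohlmann `4`-sets of `(Pt, phi)`. -/
theorem mem_hodgeSets_iff (P : Finset Coordinates.Pt) : P ∈ Coordinates.hodgeSets ↔ P.card = 4 ∧ IsHodgeSetOn cc_C6 Coordinates.phi P := by
  simp only [Coordinates.hodgeSets, mem_filter, mem_powersetCard, subset_univ, true_and]
  constructor
  · rintro ⟨h4, h⟩
    exact ⟨h4, (eq32_two_iff P h4).1 h⟩
  · rintro ⟨h4, h⟩
    exact ⟨h4, (eq32_two_iff P h4).2 h⟩

/-- The sealed `divisorSets` are the Pohlmann `2`-sets of `(Pt, phi)`. -/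
theorem mem_divisorSets_iff (P : Finset Coordinates.Pt) :
    P ∈ Coordinates.divisorSets ↔ P.card = 2 ∧ IsHodgeSetOn cc_C6 Coordinates.phi P := by
  simp only [Coordinates.divisorSets, mem_filter, mem_powersetCard, subset_univ, true_and]
  constructor
  · rintro ⟨h2, h⟩
    exact ⟨h2, (eq32_one_iff P h2).1 h⟩
  · rintro ⟨h2, h⟩
    exact ⟨h2, (eq32_one_iff P h2).2 h⟩

/-- `|hodgeSets|` is the Hodge count `hodgeCountOn cc_C6 phi 2` of the `G`-set model. -/
theorem card_hodgeSets_eq : Coordinates.hodgeSets.card = hodgeCountOn cc_C6 Coordinates.phi 2 := by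
  unfold hodgeCountOn
  congr 1
  ext P
  rw [mem_hodgeSets_iff, mem_filter]
  simp

/-- `|divisorSets|` is the Hodge count `hodgeCountOn cc_C6 phi 1`. -/
theorem card_divisorSets_eq : Coordinates.divisorSets.card = hodgeCountOn cc_C6 Coordinates.phi 1 := by
  unfold hodgeCountOn
  congr 1
  ext P
  rw [mem_divisorSets_iff, mem_filter]
  simp

/-- The sealed non-`c`-stability test `∃ x ∈ P, act 3 x ∉ P` says `cc_C6 • P ≠ P`. -/
theorem exists_act_three_not_mem_iff (P : Finset Coordinates.Pt) :
    (∃ x ∈ P, Coordinates.act 3 x ∉ P) ↔ cc_C6 • P ≠ P := by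
  rw [Ne, cc_C6_isComplexConj.smul_eq_self_iff_on]
  push Not
  rfl

/-- The sealed exceptional `4`-sets (the Weil plane of `(B × E, k)`) are the exceptional Pohlmann sets
`IsExceptionalOn cc_C6 phi` of size `4`. -/
theorem filter_hodgeSets_eq :
    (Coordinates.hodgeSets.filter fun P => ∃ x ∈ P, Coordinates.act 3 x ∉ P) =
      univ.filter fun P : Finset Coordinates.Pt => P.card = 2 * 2 ∧ IsExceptionalOn cc_C6 Coordinates.phi P := by
  ext P
  simp only [mem_filter, mem_hodgeSets_iff, exists_act_three_not_mem_iff, mem_univ, true_and,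
    IsExceptionalOn, Nat.reduceMul, and_assoc]

/-- The numbers of the sealed clause (4) read in the model: `B¹(B × E) = 4 = 4 + 0` and
`B²(B × E) = 8 = 6 + 2` (divisor-generated + exceptional), by `decide` over the `256` subsets of `Pt`. -/
theorem counts_phi :
    hodgeCountOn cc_C6 Coordinates.phi 1 = 4 ∧ divisorCountOn Coordinates.Pt cc_C6 1 = 4 ∧ exceptionalCountOn cc_C6 Coordinates.phi 1 = 0 ∧
    hodgeCountOn cc_C6 Coordinates.phi 2 = 8 ∧ divisorCountOn Coordinates.Pt cc_C6 2 = 6 ∧ exceptionalCountOn cc_C6 Coordinates.phi 2 = 2 := by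
  decide

/-- `B²(B × E) = 8 = 6 + 2` is an instance of `hodgeCountOn_eq_add`. -/
theorem hodgeCountOn_phi_two_eq_add :
    hodgeCountOn cc_C6 Coordinates.phi 2 = divisorCountOn Coordinates.Pt cc_C6 2 + exceptionalCountOn cc_C6 Coordinates.phi 2 :=
  hodgeCountOn_eq_add cc_C6_isComplexConj 2

end SexticBridge

end HodgeRepro
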